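import Summits.QuantumFields.YangMills.Theorems.WeakCouplingRatesColdBoxTwoPointFloorStubBoxGaussianWick
import Literature.MathematicalPhysics.QuantumFieldTheory.PlaquetteChains
import Literature.MathematicalPhysics.QuantumFieldTheory.LatticeConvolution
import Literature.MathematicalPhysics.QuantumFieldTheory.U1CoulombSheetEnergy
import Literature.MathematicalPhysics.QuantumFieldTheory.LatticeAxialGauge
import Summits.QuantumFields.YangMills.Theorems.WeakCouplingRatesBoxProjection

/-!
# Route `WeakCouplingRates`, crux `ColdBoxTwoPointFloorW`, stub S4 `stub_boxKernelVsLattice`: the Hodge split of a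
# plaquette point mass, the comb gauge, and the box kernel as a projection — comparison with error

Helper file 2/4 (fleet seat `ym-wcr-19608-p2`, item stmt-QuantumFields-19608, line `birth`, skeleton v5).  With the S4 objects
of `Theorems/WeakCouplingRatesDefs.lean` (`boxProjKernel`, `greenTensor`, `boxCutoff`) and the projection algebra of
`Theorems/WeakCouplingRatesBoxProjection.lean`:

* `negLap₂_greenTensor`, `d₁_div₂_add_div₃_d₂_greenTensor` — **the Hodge split of the point mass** `δ_q` on the plaquettes of
  `ℤ^d` (`d ≥ 3`): `d₁ (div₂ g_q) + div₃ (d₂ g_q) = δ_q`, from the tree's lattice Hodge identity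
  `LatticeChain.div₃_d₂_add_d₁_div₂` and the Poisson equation `latticeLaplacianZd_half_latticeGreen`;
* `exists_free_curl_eq` — **gauge reduction**: every curl field on the box is the curl of a comb-gauge (free-edge) edge
  function (`AxialGauge.gaugeFix` in the group `Multiplicative ℝ`, `LatticeForm.d₁_d₀`);
* `sum_div₃_mul_coeff_dotProduct_eq_zero` — divergences of 3-chains inside the box are orthogonal to all curls (summation by
  parts `LatticeChain.pair₂_div₃`, `LatticeForm.d₂_d₁`, and the plaquette-field dictionary `pair₂_fluxChain_left`);
* `abs_boxProjKernel_sub_curl_le` — **the comparison with error**: for plaquettes `p, q` of the box `{0,…,2H}⁴` and any scalar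
  cut-off `χ` supported in the inner box, `|boxProjKernel H p q − (d₁ div₂ g_q)(p)| ≤ Σ_{p'} |(d₁ div₂ g_p)(p')|·|V_q(p')| + ‖V_p‖‖V_q‖`
  with `V_x = div₃ ((1−χ)·d₂ g_x)`.  The decay bounds making the right side `O(H⁻⁴)` and the identification
  `(d₁ div₂ g_q)(p) = curvatureTwoPoint p q` are the next files.

No sorry, standard axioms; no new definition.  NOT a claim about the mass gap.
-/

set_option autoImplicit false

noncomputable section

open MeasureTheory Finset Matrix
open Literature.Probability.LatticeModels
open Literature.MathematicalPhysics.QuantumLattice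
open Literature.MathematicalPhysics.QuantumFieldTheory
open Literature.MathematicalPhysics.QuantumFieldTheory.LatticeMaxwell
open Literature.MathematicalPhysics.QuantumFieldTheory.AxialGauge
open Literature.MathematicalPhysics.QuantumFieldTheory.LatticeChain
open Literature.MathematicalPhysics.QuantumFieldTheory.LatticeForm (e d₀ d₁ d₂ d₁_d₀ d₂_d₁ d₁_swap d₁_sub)

namespace Summit.QuantumFields.YangMills.Theorems.WeakCouplingRates



variable {H : ℕ}

/-! ## The Green 2-tensor and the Hodge split of `δ_q` -/

/-- `greenTensor q` is alternating. -/
theorem isAltR₂_greenTensor {d : ℕ} (q : Plaq d) : IsAltR₂ (greenTensor q) := by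
  intro y i j
  simp only [greenTensor]
  have h1 : (j = q.2.1 ∧ i = q.2.2) ↔ (i = q.2.2 ∧ j = q.2.1) := and_comm
  have h2 : (j = q.2.2 ∧ i = q.2.1) ↔ (i = q.2.1 ∧ j = q.2.2) := and_comm
  simp only [h1, h2]
  ring

/-- `Σᵢ ((F z − F(z+eᵢ)) + (F z − F(z−eᵢ))) = −(Δ F)(z)` (the tree's `latticeLaplacianZd`). -/
theorem sum_sub_add_sub_eq_neg_latticeLaplacianZd {d : ℕ} (F : Site d → ℝ) (z : Site d) :
    ∑ i : Fin d, ((F z - F (z + e i)) + (F z - F (z - e i))) = -latticeLaplacianZd F z := by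
  simp only [latticeLaplacianZd, LatticeForm.e, Finset.sum_add_distrib, Finset.sum_sub_distrib, Finset.sum_const,
    Finset.card_univ, Fintype.card_fin, nsmul_eq_mul]
  ring

/-- `−Δ` of the Green 2-tensor is the elementary 2-chain of `q` (`d ≥ 3`): `negLap₂ (greenTensor q) = plaqChain q`. -/
theorem negLap₂_greenTensor {d : ℕ} (hd : 3 ≤ d) (q : Plaq d) :
    negLap₂ (greenTensor q) = (plaqChain q : Site d → Fin d → Fin d → ℝ) := by
  funext y k l
  obtain ⟨x, i, j⟩ := q
  have hP := latticeLaplacianZd_half_latticeGreen d hd (y - x)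
  set ω : ℝ := (if k = i ∧ l = j then 1 else 0) - (if k = j ∧ l = i then 1 else 0) with hω
  set F : Site d → ℝ := fun z => latticeGreen z / 2 with hF
  have e1 : ∀ m : Fin d, y + e m - x = y - x + e m := fun m => by abel
  have e2 : ∀ m : Fin d, y - e m - x = y - x - e m := fun m => by abel
  have hL : negLap₂ (greenTensor ((x, i, j) : Plaq d)) y k l =
      ω * ∑ m : Fin d, ((F (y - x) - F (y - x + e m)) + (F (y - x) - F (y - x - e m))) := by
    simp only [negLap₂, greenTensor, hF, Finset.mul_sum, e1, e2]
    exact Finset.sum_congr rfl fun m _ => by ring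
  rw [hL, sum_sub_add_sub_eq_neg_latticeLaplacianZd, hP, neg_neg]
  simp only [plaqChain, hω, Prod.mk.injEq]
  have hc : (k = j ∧ l = i) ↔ (l = i ∧ k = j) := and_comm
  by_cases hy : y = x
  · simp [hy, hc]
  · have h0 : y - x ≠ 0 := fun h => hy (sub_eq_zero.1 h)
    simp [h0, hy]

/-- **The Hodge split of the point mass at `q`** (`d ≥ 3`):
`d₁ (div₂ g_q) + div₃ (d₂ g_q) = δ_q` with `g_q = greenTensor q`, `δ_q = plaqChain q`. -/
theorem d₁_div₂_add_div₃_d₂_greenTensor {d : ℕ} (hd : 3 ≤ d) (q : Plaq d) :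
    d₁ (div₂ (greenTensor q)) + div₃ (d₂ (greenTensor q)) = (plaqChain q : Site d → Fin d → Fin d → ℝ) := by
  rw [add_comm, div₃_d₂_add_d₁_div₂, negLap₂_greenTensor hd]

/-- The co-potential `d₂ g_q` is totally alternating. -/
theorem isAltR₃_d₂_greenTensor {d : ℕ} (q : Plaq d) : IsAltR₃ (d₂ (greenTensor q)) :=
  isAltR₃_d₂ (isAltR₂_greenTensor q)

/-! ## Curls of comb-gauge edge functions: `λ_p · s = (d₁ ψ_s)(p)` and the gauge reduction -/

/-- The circulation coefficient vector paired with free values is the curl of the glued edge function: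
`λ_p · s = sCirc (glue 0 s) p`. -/
theorem coeff_dotProduct_eq_sCirc (n : ℕ) (s : LatticeMaxwell.Free (AxialGauge.IsComb (d := 4)) (0 : Site 4) n → ℝ)
    (p : Plaq 4) :
    coeff IsComb (0 : Site 4) n p ⬝ᵥ s = sCirc (LatticeMaxwell.glue (pin := IsComb) (0 : Site 4) n 0 s) p := by
  rw [sCirc_glue, bterm]
  have : sCirc (LatticeMaxwell.glue (pin := IsComb) (0 : Site 4) n (0 : Literature.MathematicalPhysics.QuantumLattice.ZdEdge 4 → ℝ)
      (0 : LatticeMaxwell.Free (AxialGauge.IsComb (d := 4)) (0 : Site 4) n → ℝ)) p = 0 := by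
    simp [sCirc, glue_zero_eq_sum]
  rw [this, add_zero]

/-- `sCirc` is the cubical coboundary `d₁` of the curried edge function. -/
theorem sCirc_eq_d₁ {d : ℕ} (A : Literature.MathematicalPhysics.QuantumLattice.ZdEdge d → ℝ) (p : Plaq d) :
    sCirc A p = d₁ (fun x i => A (x, i)) p.1 p.2.1 p.2.2 := by
  simp only [sCirc, LatticeForm.d₁, LatticeForm.e]

/-- **Gauge reduction to the comb gauge.**  Every curl field on the plaquettes of the box `{0,…,n-1}⁴` is the curl of
an edge function supported on the FREE (non-comb) edges: for every `φ` there is `s ∈ ℝ^{Free}` with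
`λ_p · s = (d₁ φ)(p)` for all plaquettes `p` of the box (axial gauge fixing, tree `AxialGauge.gaugeFix` in the
group `Multiplicative ℝ`, plus `d₁ ∘ d₀ = 0`). -/
theorem exists_free_curl_eq (n : ℕ) (φ : Site 4 → Fin 4 → ℝ) :
    ∃ s : LatticeMaxwell.Free (AxialGauge.IsComb (d := 4)) (0 : Site 4) n → ℝ,
      ∀ p ∈ plaquettesIn (halfOpenBox 4 n), coeff IsComb (0 : Site 4) n p ⬝ᵥ s = d₁ φ p.1 p.2.1 p.2.2 := by
  -- the multiplicative configuration and its axial gauge fixing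
  set U : ZdGaugeConfig 4 (Multiplicative ℝ) := fun e => Multiplicative.ofAdd (φ e.1 e.2) with hU
  set g : Site 4 → ℝ := fun x => Multiplicative.toAdd (combGauge U x) with hg
  set Ψ : Literature.MathematicalPhysics.QuantumLattice.ZdEdge 4 → ℝ := fun e => Multiplicative.toAdd (gaugeFix U e) with hΨ
  have hΨ_eq : ∀ x i, Ψ (x, i) = (φ - d₀ g) x i := by
    intro x i
    simp only [hΨ, hg, gaugeFix_apply, toAdd_mul, toAdd_inv, Pi.sub_apply, LatticeForm.d₀, LatticeForm.e, hU,
      toAdd_ofAdd]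
    ring
  have hΨ_comb : ∀ e ∈ boxEdges 4 n, IsComb e → Ψ e = 0 := by
    rintro ⟨x, i⟩ he hc
    have hx : 0 ≤ x i := ((mem_boxEdges_iff.1 he).1 i).1
    simp only [hΨ, gaugeFix_of_isComb hc hx, toAdd_one]
  refine ⟨fun e => Ψ e.1.1, fun p hp => ?_⟩
  rw [coeff_dotProduct_eq_sCirc]
  -- the glued function agrees with `Ψ` on the four edges of `p`
  have hglue : ∀ e ∈ boxEdges 4 n, LatticeMaxwell.glue (pin := IsComb) (0 : Site 4) n 0
      (fun e : LatticeMaxwell.Free (AxialGauge.IsComb (d := 4)) (0 : Site 4) n => Ψ e.1.1) e = Ψ e := by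
    intro e he
    have he' : e ∈ boxEdgesAt (0 : Site 4) n := mem_boxEdgesAt_zero.2 he
    by_cases hc : IsComb e
    · rw [glue_apply_pin _ _ he' hc, hΨ_comb e he hc]; rfl
    · exact glue_apply_free 0 _ ⟨⟨e, he'⟩, hc⟩
  obtain ⟨h1, h2, h3, h4⟩ := edges_mem_boxEdges hp
  rw [sCirc, hglue _ h1, hglue _ h2, hglue _ h3, hglue _ h4]
  have : d₁ φ p.1 p.2.1 p.2.2 = d₁ (φ - d₀ g) p.1 p.2.1 p.2.2 := by
    rw [d₁_sub, d₁_d₀, sub_zero]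
  rw [this]
  simp only [LatticeForm.d₁, LatticeForm.e, hΨ_eq]

/-! ## Divergences of 3-chains inside the box are orthogonal to all curls -/

/-- Adding a `0/1`-vector to a site of the inner box `{0,…,n-2}⁴` stays in the box `{0,…,n-1}⁴`. -/
theorem add_mem_halfOpenBox_of_inner {n : ℕ} {y : Site 4} (hy : y ∈ halfOpenBox 4 (n - 1)) {v : Site 4}
    (hv : ∀ m, 0 ≤ v m ∧ v m ≤ 1) : y + v ∈ halfOpenBox 4 n := by
  rw [mem_halfOpenBox] at hy ⊢
  intro m
  have := hy m; have := hv m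
  simp only [Pi.add_apply]
  constructor <;> omega

/-- `eⱼ` is a `0/1`-vector. -/
theorem single_bounds {d : ℕ} (j m : Fin d) : 0 ≤ (e j : Site d) m ∧ (e j : Site d) m ≤ 1 := by
  simp only [LatticeForm.e, Pi.single_apply]
  split_ifs <;> simp

/-- `eⱼ + e_k` is a `0/1`-vector for `j ≠ k`. -/
theorem single_add_single_bounds {d : ℕ} {j k : Fin d} (hjk : j ≠ k) (m : Fin d) :
    0 ≤ (e j + e k : Site d) m ∧ (e j + e k : Site d) m ≤ 1 := by
  simp only [LatticeForm.e, Pi.add_apply, Pi.single_apply]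
  by_cases h1 : m = j
  · subst h1; simp [hjk]
  · by_cases h2 : m = k
    · subst h2; simp [h1]
    · simp [h1, h2]

/-- `eᵢ + eⱼ + e_k` is a `0/1`-vector for pairwise distinct `i, j, k`. -/
theorem single_add_single_add_single_bounds {d : ℕ} {i j k : Fin d} (hij : i ≠ j) (hik : i ≠ k) (hjk : j ≠ k)
    (m : Fin d) : 0 ≤ (e i + e j + e k : Site d) m ∧ (e i + e j + e k : Site d) m ≤ 1 := by
  simp only [LatticeForm.e, Pi.add_apply, Pi.single_apply]
  by_cases h1 : m = i
  · subst h1; simp [hij, hik]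
  · by_cases h2 : m = j
    · subst h2; simp [h1, hjk]
    · by_cases h3 : m = k
      · subst h3; simp [h1, h2]
      · simp [h1, h2, h3]

/-- A plaquette `(y; k, l)` with `k ≠ l` based at an inner site is a plaquette of the box (in one of its two
orientations). -/
theorem mem_plaquettesIn_of_inner {n : ℕ} {y : Site 4} (hy : y ∈ halfOpenBox 4 (n - 1)) {k l : Fin 4} (hkl : k ≠ l) :
    (y, k, l) ∈ plaquettesIn (halfOpenBox 4 n) ∨ (y, l, k) ∈ plaquettesIn (halfOpenBox 4 n) := by
  have h0 : y ∈ halfOpenBox 4 n := by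
    simpa using add_mem_halfOpenBox_of_inner hy (v := 0) (fun m => by simp)
  have hk := add_mem_halfOpenBox_of_inner hy (single_bounds k)
  have hl := add_mem_halfOpenBox_of_inner hy (single_bounds l)
  have hkl' := add_mem_halfOpenBox_of_inner hy (single_add_single_bounds hkl)
  rcases lt_or_gt_of_ne hkl with h | h
  · left
    refine Plaq.mem_plaquettesIn.2 ⟨h0, h, hk, hl, ?_⟩
    simpa [LatticeForm.e, add_assoc] using hkl'
  · right
    refine Plaq.mem_plaquettesIn.2 ⟨h0, h, hl, hk, ?_⟩
    have : (e k + e l : Site 4) = e l + e k := add_comm _ _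
    rw [this] at hkl'
    simpa [LatticeForm.e, add_assoc] using hkl'

/-- The divergence of a totally alternating 3-tensor supported on sites of the inner box `{0,…,n-2}⁴` is supported on the plaquettes of
the box. -/
theorem div₃_support {n : ℕ} {R : Site 4 → Fin 4 → Fin 4 → Fin 4 → ℝ} (hR : IsAltR₃ R)
    (hsupp : ∀ y i j k, R y i j k ≠ 0 → y ∈ halfOpenBox 4 (n - 1)) (y : Site 4) (k l : Fin 4)
    (h : div₃ R y k l ≠ 0) :
    (y, k, l) ∈ plaquettesIn (halfOpenBox 4 n) ∨ (y, l, k) ∈ plaquettesIn (halfOpenBox 4 n) := by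
  obtain ⟨j, -, hj⟩ := Finset.exists_ne_zero_of_sum_ne_zero h
  -- alternation: a nonzero entry has pairwise distinct indices
  have hdist : ∀ z a b c, R z a b c ≠ 0 → a ≠ b ∧ b ≠ c ∧ a ≠ c := by
    intro z a b c hz
    refine ⟨fun hab => hz ?_, fun hbc => hz ?_, fun hac => hz ?_⟩
    · subst hab; have := hR.1 z a a c; linarith
    · subst hbc; have := hR.2 z a b b; linarith
    · subst hac
      have h1 := hR.1 z a b a; have h2 := hR.2 z b a a; have h3 := hR.1 z b a a
      linarith
  by_cases h1 : R (y - e j) j k l ≠ 0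
  · obtain ⟨hjk, hkl, hjl⟩ := hdist _ _ _ _ h1
    have hin := hsupp _ _ _ _ h1
    -- `y = (y - e j) + e j`
    have hy0 : y = (y - e j) + e j := by abel
    have hy : y ∈ halfOpenBox 4 n := by
      rw [hy0]; exact add_mem_halfOpenBox_of_inner hin (single_bounds j)
    have hyk : y + e k ∈ halfOpenBox 4 n := by
      have : y + e k = (y - e j) + (e j + e k) := by abel
      rw [this]; exact add_mem_halfOpenBox_of_inner hin (single_add_single_bounds hjk)
    have hyl : y + e l ∈ halfOpenBox 4 n := by
      have : y + e l = (y - e j) + (e j + e l) := by abel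
      rw [this]; exact add_mem_halfOpenBox_of_inner hin (single_add_single_bounds hjl)
    have hykl : y + e k + e l ∈ halfOpenBox 4 n := by
      have : y + e k + e l = (y - e j) + (e j + e k + e l) := by abel
      rw [this]
      exact add_mem_halfOpenBox_of_inner hin (single_add_single_add_single_bounds hjk hjl hkl)
    rcases lt_or_gt_of_ne hkl with h | h
    · left; exact Plaq.mem_plaquettesIn.2 ⟨hy, h, hyk, hyl, hykl⟩
    · right
      refine Plaq.mem_plaquettesIn.2 ⟨hy, h, hyl, hyk, ?_⟩
      rwa [add_right_comm]
  · push Not at h1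
    have h2 : R y j k l ≠ 0 := by intro h2; apply hj; rw [h1, h2, sub_zero]
    obtain ⟨-, hkl, -⟩ := hdist _ _ _ _ h2
    exact mem_plaquettesIn_of_inner (hsupp _ _ _ _ h2) hkl

/-- **Divergences of 3-chains inside the box are orthogonal to every curl**: for a finitely supported totally
alternating 3-tensor `R` supported on sites of the inner box `{0,…,n-2}⁴` and every free edge function `s`,
`Σ_{p ∈ box} (div₃ R)(p) · (λ_p · s) = 0` — summation by parts `⟪∂R, d₁ψ⟫ = ⟪R, d₂ d₁ ψ⟫ = 0`
(tree `LatticeChain.pair₂_div₃`, `LatticeForm.d₂_d₁`). -/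
theorem sum_div₃_mul_coeff_dotProduct_eq_zero {n : ℕ} {R : Site 4 → Fin 4 → Fin 4 → Fin 4 → ℝ}
    (hR : IsAltR₃ R) (hfin : Function.HasFiniteSupport R) (hsupp : ∀ y i j k, R y i j k ≠ 0 → y ∈ halfOpenBox 4 (n - 1))
    (s : LatticeMaxwell.Free (AxialGauge.IsComb (d := 4)) (0 : Site 4) n → ℝ) :
    ∑ p ∈ plaquettesIn (halfOpenBox 4 n), div₃ R p.1 p.2.1 p.2.2 * (coeff IsComb (0 : Site 4) n p ⬝ᵥ s) = 0 := by
  set ψ : Site 4 → Fin 4 → ℝ := fun x i => LatticeMaxwell.glue (pin := IsComb) (0 : Site 4) n 0 s (x, i) with hψ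
  have hcurl : ∀ p : Plaq 4, coeff IsComb (0 : Site 4) n p ⬝ᵥ s = d₁ ψ p.1 p.2.1 p.2.2 := fun p => by
    rw [coeff_dotProduct_eq_sCirc, sCirc_eq_d₁]
  simp_rw [hcurl]
  have halt : IsAltR₂ (d₁ ψ) := fun y i j => d₁_swap ψ y i j
  -- rewrite the plaquette sum as the pairing `pair₂`
  have hflux : fluxChain (halfOpenBox 4 n) (ofChain (halfOpenBox 4 n) (div₃ R)) = div₃ R :=
    fluxChain_ofChain (isAltR₂_div₃ hR) (div₃_support hR hsupp)
  have hpair := pair₂_fluxChain_left (ofChain (halfOpenBox 4 n) (div₃ R)) halt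
  rw [hflux] at hpair
  have hsum : ∑ p ∈ plaquettesIn (halfOpenBox 4 n), div₃ R p.1 p.2.1 p.2.2 * d₁ ψ p.1 p.2.1 p.2.2 =
      ∑ p : ↥(plaquettesIn (halfOpenBox 4 n)),
        ofChain (halfOpenBox 4 n) (div₃ R) p * d₁ ψ (p : Plaq 4).1 (p : Plaq 4).2.1 (p : Plaq 4).2.2 := by
    rw [← Finset.sum_coe_sort]; rfl
  rw [hsum, ← hpair, pair₂_div₃ hfin hR, d₂_d₁]
  simp [pair₃]

/-! ## The decomposition of `δ_q` on the plaquettes of the box and the comparison theorem -/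

/-- Scaling a totally alternating 3-tensor sitewise keeps it totally alternating. -/
theorem isAltR₃_smul_site {d : ℕ} (χ : Site d → ℝ) {W : Site d → Fin d → Fin d → Fin d → ℝ} (hW : IsAltR₃ W) :
    IsAltR₃ (fun y a b c => χ y * W y a b c) :=
  ⟨fun y a b c => by dsimp only; rw [hW.1 y a b c, mul_neg], fun y a b c => by dsimp only; rw [hW.2 y a b c, mul_neg]⟩

/-- A sitewise-scaled tensor with scaling function supported in a finite set is finitely supported. -/
theorem hasFiniteSupport_smul_site {n : ℕ} {χ : Site 4 → ℝ} (hχ : ∀ y, χ y ≠ 0 → y ∈ halfOpenBox 4 n)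
    (W : Site 4 → Fin 4 → Fin 4 → Fin 4 → ℝ) :
    Function.HasFiniteSupport (fun y a b c => χ y * W y a b c) := by
  refine ((halfOpenBox 4 n).finite_toSet).subset fun y hy => ?_
  simp only [Function.mem_support, ne_eq] at hy
  simp only [Finset.mem_coe]
  by_contra hcon
  apply hy
  funext a b c
  have : χ y = 0 := by
    by_contra h0
    exact hcon (hχ y h0)
  rw [this, zero_mul]
  rfl

/-- `div₃` is additive in the sitewise split `W = χW + (1−χ)W`. -/
theorem div₃_split {d : ℕ} (χ : Site d → ℝ) (W : Site d → Fin d → Fin d → Fin d → ℝ) (y : Site d) (k l : Fin d) :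
    div₃ W y k l = div₃ (fun y a b c => χ y * W y a b c) y k l + div₃ (fun y a b c => (1 - χ y) * W y a b c) y k l := by
  simp only [div₃, ← Finset.sum_add_distrib]
  exact Finset.sum_congr rfl fun m _ => by ring

/-- **The decomposition of the point mass on the plaquettes of the box.**  For a plaquette `q` of the box
`{0,…,n-1}⁴` and any scalar `χ`, on every plaquette `p'` of the box:
`δ_q(p') = (d₁ div₂ g_q)(p') + (div₃ (χ·d₂ g_q))(p') + (div₃ ((1−χ)·d₂ g_q))(p')`. -/
theorem pointMass_eq_curl_add_div₃_add_div₃ {n : ℕ} {q : Plaq 4} (hq : q ∈ plaquettesIn (halfOpenBox 4 n))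
    (χ : Site 4 → ℝ) {p' : Plaq 4} (hp' : p' ∈ plaquettesIn (halfOpenBox 4 n)) :
    (if p' = q then (1 : ℝ) else 0) =
      d₁ (div₂ (greenTensor q)) p'.1 p'.2.1 p'.2.2 +
        div₃ (fun y a b c => χ y * d₂ (greenTensor q) y a b c) p'.1 p'.2.1 p'.2.2 +
        div₃ (fun y a b c => (1 - χ y) * d₂ (greenTensor q) y a b c) p'.1 p'.2.1 p'.2.2 := by
  have h := congrFun (congrFun (congrFun (d₁_div₂_add_div₃_d₂_greenTensor (by norm_num : 3 ≤ 4) q) p'.1)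
    p'.2.1) p'.2.2
  simp only [Pi.add_apply] at h
  rw [add_assoc, ← div₃_split, h, plaqChain]
  obtain ⟨y, k, l⟩ := p'
  have hswap : ¬ ((y, l, k) : Plaq 4) = q := by
    intro heq
    exact swap_not_mem_plaquettesIn hp' (heq ▸ hq)
  simp [hswap]

/-- The precision matrix of the untranslated box is the Gram matrix of the circulation vectors over its plaquettes. -/
theorem boxQmat_eq_sum (H : ℕ) :
    Qmat (AxialGauge.IsComb (d := 4)) (0 : Site 4) (2 * H + 1) =
      ∑ p ∈ plaquettesIn (halfOpenBox 4 (2 * H + 1)),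
        vecMulVec (coeff IsComb (0 : Site 4) (2 * H + 1) p) (coeff IsComb (0 : Site 4) (2 * H + 1) p) := by
  rw [Qmat]
  exact Finset.sum_congr rfl fun p _ => by rw [shift_zero]

/-- **The box kernel versus the `ℤ⁴` curl kernel, with error** (S4 core).  For plaquettes `p, q` of the box `{0,…,2H}⁴`
and any scalar `χ` with `{χ ≠ 0}` inside the inner box `{0,…,2H−1}⁴`,
`|boxProjKernel H p q − (d₁ div₂ g_q)(p)| ≤ Σ_{p'} |(d₁ div₂ g_p)(p')| |V_q(p')| + ‖V_p‖ ‖V_q‖`,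
`V_x = div₃ ((1−χ)·d₂ g_x)` on the plaquettes of the box — the projection algebra of
`Theorems/WeakCouplingRatesBoxProjection.lean` fed with the Hodge split, the comb gauge and the orthogonality of
`div₃ (χ·d₂ g)` to all curls. -/
theorem abs_boxProjKernel_sub_curl_le (H : ℕ) {p q : Plaq 4}
    (hp : p ∈ plaquettesIn (halfOpenBox 4 (2 * H + 1))) (hq : q ∈ plaquettesIn (halfOpenBox 4 (2 * H + 1)))
    {χ : Site 4 → ℝ} (hχ : ∀ y, χ y ≠ 0 → y ∈ halfOpenBox 4 (2 * H + 1 - 1)) :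
    |boxProjKernel H p q - d₁ (div₂ (greenTensor q)) p.1 p.2.1 p.2.2| ≤
      ∑ p' ∈ plaquettesIn (halfOpenBox 4 (2 * H + 1)),
          |d₁ (div₂ (greenTensor p)) p'.1 p'.2.1 p'.2.2| *
            |div₃ (fun y a b c => (1 - χ y) * d₂ (greenTensor q) y a b c) p'.1 p'.2.1 p'.2.2| +
        Real.sqrt (∑ p' ∈ plaquettesIn (halfOpenBox 4 (2 * H + 1)),
            div₃ (fun y a b c => (1 - χ y) * d₂ (greenTensor p) y a b c) p'.1 p'.2.1 p'.2.2 ^ 2) *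
          Real.sqrt (∑ p' ∈ plaquettesIn (halfOpenBox 4 (2 * H + 1)),
            div₃ (fun y a b c => (1 - χ y) * d₂ (greenTensor q) y a b c) p'.1 p'.2.1 p'.2.2 ^ 2) := by
  -- gauge: the curl parts are curls of free edge functions
  obtain ⟨sq, hsq⟩ := exists_free_curl_eq (2 * H + 1) (div₂ (greenTensor q))
  obtain ⟨sp, hsp⟩ := exists_free_curl_eq (2 * H + 1) (div₂ (greenTensor p))
  have hK : ∀ p' q' : Plaq 4, boxProjKernel H p' q' =
      coeff IsComb (0 : Site 4) (2 * H + 1) p' ⬝ᵥ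
        (Qmat (AxialGauge.IsComb (d := 4)) (0 : Site 4) (2 * H + 1))⁻¹ *ᵥ coeff IsComb (0 : Site 4) (2 * H + 1) q' :=
    fun _ _ => rfl
  have hδq : ∀ p' ∈ plaquettesIn (halfOpenBox 4 (2 * H + 1)), (if p' = q then (1 : ℝ) else 0) =
      coeff IsComb (0 : Site 4) (2 * H + 1) p' ⬝ᵥ sq +
        div₃ (fun y a b c => χ y * d₂ (greenTensor q) y a b c) p'.1 p'.2.1 p'.2.2 +
        div₃ (fun y a b c => (1 - χ y) * d₂ (greenTensor q) y a b c) p'.1 p'.2.1 p'.2.2 := fun p' hp' => by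
    rw [hsq p' hp']; exact pointMass_eq_curl_add_div₃_add_div₃ hq χ hp'
  have hδp : ∀ p' ∈ plaquettesIn (halfOpenBox 4 (2 * H + 1)), (if p' = p then (1 : ℝ) else 0) =
      coeff IsComb (0 : Site 4) (2 * H + 1) p' ⬝ᵥ sp +
        div₃ (fun y a b c => χ y * d₂ (greenTensor p) y a b c) p'.1 p'.2.1 p'.2.2 +
        div₃ (fun y a b c => (1 - χ y) * d₂ (greenTensor p) y a b c) p'.1 p'.2.1 p'.2.2 := fun p' hp' => by
    rw [hsp p' hp']; exact pointMass_eq_curl_add_div₃_add_div₃ hp χ hp'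
  have hnq : ∀ s, ∑ p' ∈ plaquettesIn (halfOpenBox 4 (2 * H + 1)),
      div₃ (fun y a b c => χ y * d₂ (greenTensor q) y a b c) p'.1 p'.2.1 p'.2.2 *
        (coeff IsComb (0 : Site 4) (2 * H + 1) p' ⬝ᵥ s) = 0 := fun s =>
    sum_div₃_mul_coeff_dotProduct_eq_zero (isAltR₃_smul_site χ (isAltR₃_d₂_greenTensor q))
      (hasFiniteSupport_smul_site hχ _) (fun y a b c h => hχ y (left_ne_zero_of_mul h)) s
  have hnp : ∀ s, ∑ p' ∈ plaquettesIn (halfOpenBox 4 (2 * H + 1)),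
      div₃ (fun y a b c => χ y * d₂ (greenTensor p) y a b c) p'.1 p'.2.1 p'.2.2 *
        (coeff IsComb (0 : Site 4) (2 * H + 1) p' ⬝ᵥ s) = 0 := fun s =>
    sum_div₃_mul_coeff_dotProduct_eq_zero (isAltR₃_smul_site χ (isAltR₃_d₂_greenTensor p))
      (hasFiniteSupport_smul_site hχ _) (fun y a b c h => hχ y (left_ne_zero_of_mul h)) s
  have hmain := abs_gramKernel_sub_le (boxQmat_eq_sum H) (posDef_boxQmat H) hK hp hq hδq hδp hnq hnp
  have hsum : ∑ p' ∈ plaquettesIn (halfOpenBox 4 (2 * H + 1)),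
      |coeff IsComb (0 : Site 4) (2 * H + 1) p' ⬝ᵥ sp| *
        |div₃ (fun y a b c => (1 - χ y) * d₂ (greenTensor q) y a b c) p'.1 p'.2.1 p'.2.2| =
      ∑ p' ∈ plaquettesIn (halfOpenBox 4 (2 * H + 1)),
        |d₁ (div₂ (greenTensor p)) p'.1 p'.2.1 p'.2.2| *
          |div₃ (fun y a b c => (1 - χ y) * d₂ (greenTensor q) y a b c) p'.1 p'.2.1 p'.2.2| :=
    Finset.sum_congr rfl fun p' hp' => by rw [hsp p' hp']
  rw [hsq p hp, hsum] at hmain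
  exact hmain

end Summit.QuantumFields.YangMills.Theorems.WeakCouplingRates

end
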